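import Summits.CriticalPhenomena.PercolationContinuityZ3.Theorems.Transplant.SkelPhiFaceNumsBox
import Summits.CriticalPhenomena.PercolationContinuityZ3.Theorems.Transplant.SkelPhiFaceSchedBoxes2
import Summits.CriticalPhenomena.PercolationContinuityZ3.Theorems.Transplant.SkelPhiRootBridgeGeom
import HarnessLib

/-!
# N1 ({±1} node), (F) inner route, part R5b-y (hp-8 g33): **THE y′-RUN'S PER-REGION FOOTPRINT FROM LINEAR FLOORS** — the fields
# `YLO/YHI, hregY, hY0–hY3, hYf₁₂₃` of `FaceRunNums3` for a y′-run `yRunSched … R′ q N` read with sign `τ` at an origin with cell readings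
# `(f₀, f₁)`, produced from six LINEAR integer inequalities per region `k` (`FY1–FY6`): the region boxes are `yRunSched_region_subset`, the
# α–β′ CORRELATION of the drifting chain (`|mod·α_end − vα·U·L| ≤ Bnd_k` over the region's levels, from `U·sLo ≤ mod ≤ nℓ < U·sHi`) feeds
# `read0_corr_lo/hi_bounds`, and the level readings `read1_gen_bounds`.
builds on p205010 (kernel theorem, internal audit signed; external expert review pending) — nothing in this file uses p205010; no claim about the open node.
Lane `prim-bschramm`, seat `prim-hp-8` (gen 33); helper file (`--supports stmt-CriticalPhenomena-4575 --as helper`).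
* defs `Skelφ.yBoxLoS/yBoxHiS/yBoxLoT/yBoxHiT` (region `k` box of the y′-run), `yBnd` (the correlation bound), `yRunSched_region_subset_yBox`,
  `yRun_corr_aux`/`yRun_corr` (the correlation bound), `ySLo/ySHi`, **`yRun_footprint_of_floors`** (the last core's target box: `SkelPhiFaceNumsYCore`).
[cite: KozmaNitzan2024, §4 Lemma 11 (pp. 22–23), Lemma 12 (pp. 23–25)] [cite: MartineauTassion2017, §4.1, §4.3 Lemma 4.2]
-/

namespace Summit.CriticalPhenomena.PercolationContinuityZ3.Theorems.Transplant

namespace Skelφ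

open Literature.Probability.Percolation Literature.Probability.LatticeModels
open Literature.Probability.Percolation.KozmaNitzan.Cells (oth oth_ne sgOf sgOf_sign eq_oth_of_ne oth_oth)
open ChainPlanar ChainPara
open TwoAxis.Para (modulus coarse lam0 lam1)

/-- Along (level) lower end of region `k` of the y′-run: `k·sLo − q − k·R′ − R′ − La`. [folklore] -/
def yBoxLoS (n ℓ : ℕ) (h : ℤ) (q R' : ℕ) (k : ℕ) : ℤ :=
  (k : ℤ) * (((n : ℤ) * ℓ - (shearUnit n h : ℕ) + 1) / (shearUnit n h : ℕ)) - q - (k : ℤ) * R' - R' - ((3 * (n * ℓ) / shearUnit n h + 1 : ℕ) : ℤ)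

/-- Along (level) upper end of region `k` of the y′-run: `k·sHi + q + k·R′ + R′ + La`. [folklore] -/
def yBoxHiS (n ℓ : ℕ) (h : ℤ) (q R' : ℕ) (k : ℕ) : ℤ :=
  (k : ℤ) * ((n : ℤ) * ℓ / (shearUnit n h : ℕ) + 1) + q + (k : ℤ) * R' + R' + ((3 * (n * ℓ) / shearUnit n h + 1 : ℕ) : ℤ)

/-- Transverse (α) lower end of region `k` of the y′-run: `k·v − ((n+v) + k·R′) − R′ − n`. [folklore] -/
def yBoxLoT (n : ℕ) (v : ℤ) (R' : ℕ) (k : ℕ) : ℤ := (k : ℤ) * v - ((((n : ℤ) + v).toNat : ℕ) + (k : ℤ) * R') - R' - n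

/-- Transverse (α) upper end of region `k` of the y′-run: `k·v + (n−v) + k·R′ + R′ + n`. [folklore] -/
def yBoxHiT (n : ℕ) (v : ℤ) (R' : ℕ) (k : ℕ) : ℤ := (k : ℤ) * v + ((((n : ℤ) - v).toNat : ℕ) + (k : ℤ) * R') + R' + n

/-- The y′-run's region `k` inside the box `[yBoxLoS, yBoxHiS] × [yBoxLoT, yBoxHiT]`. [folklore] -/
theorem yRunSched_region_subset_yBox {n ℓ : ℕ} {h v : ℤ} (hn : 1 ≤ n) (hv : |v| ≤ n) (hlay : (n + h.natAbs : ℕ) ≤ (n : ℤ) * ℓ + 1)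
    (R' q N k : ℕ) :
    (yRunSched hn hv hlay R' q N).region k ⊆
      Finset.Icc (pt (yBoxLoS n ℓ h q R' k) (yBoxLoT n v R' k)) (pt (yBoxHiS n ℓ h q R' k) (yBoxHiT n v R' k)) := by
  intro y hy
  have hy' := yRunSched_region_subset hn hv hlay R' q N k hy
  rw [mem_Icc_pt_iff] at hy' ⊢
  obtain ⟨⟨h1, h2⟩, h3, h4⟩ := hy'
  unfold yBoxLoS yBoxHiS yBoxLoT yBoxHiT
  refine ⟨⟨by linarith, by linarith⟩, by linarith, by linarith⟩

/-- **The correlation bound of region `k`**: `Bnd_k = mod·(3n + (k+1)·R′) + n·U·(2k + q + (k+1)·R′ + La + 2)`, `La = 3nℓ/U + 1`. [this work] -/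
def yBnd (n ℓ : ℕ) (h mod : ℤ) (q R' : ℕ) (k : ℕ) : ℤ :=
  mod * (3 * (n : ℤ) + ((k : ℤ) + 1) * R') +
    (n : ℤ) * (shearUnit n h : ℤ) * (2 * (k : ℤ) + q + ((k : ℤ) + 1) * R' + ((3 * (n * ℓ) / shearUnit n h + 1 : ℕ) : ℤ) + 2)

/-- The correlation bound, unsigned form: for `m ∈ [yBoxLoT, yBoxHiT]` and `L ∈ [yBoxLoS − 1, yBoxHiS + 1]`, `|mod·m − v·U·L| ≤ Bnd_k`
(`nℓ − U + 1 ≤ mod ≤ nℓ`: the top layer; `|v| ≤ n`). [cite: MartineauTassion2017, §4.1] -/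
theorem yRun_corr_aux {n ℓ : ℕ} (hn : 1 ≤ n) {h v mod : ℤ} (hv : |v| ≤ n) (hmod0 : 0 < mod)
    (hmodlo : (n : ℤ) * ℓ - (shearUnit n h : ℤ) + 1 ≤ mod) (hmodhi : mod ≤ (n : ℤ) * ℓ) (q R' k : ℕ) {m L : ℤ}
    (hm1 : yBoxLoT n v R' k ≤ m) (hm2 : m ≤ yBoxHiT n v R' k) (hL1 : yBoxLoS n ℓ h q R' k - 1 ≤ L) (hL2 : L ≤ yBoxHiS n ℓ h q R' k + 1) :
    |mod * m - v * ((shearUnit n h : ℤ) * L)| ≤ yBnd n ℓ h mod q R' k := by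
  have hU0 : 0 < (shearUnit n h : ℤ) := shearUnit_pos hn h
  have hn0 : (0 : ℤ) < n := by exact_mod_cast hn
  have hvv := abs_le.1 hv
  have hk0 : (0 : ℤ) ≤ k := by positivity
  -- the transverse ends about `k·v`
  unfold yBoxLoT at hm1
  unfold yBoxHiT at hm2
  rw [Int.toNat_of_nonneg (by linarith : (0 : ℤ) ≤ (n : ℤ) + v)] at hm1
  rw [Int.toNat_of_nonneg (by linarith : (0 : ℤ) ≤ (n : ℤ) - v)] at hm2
  have hdm : |m - (k : ℤ) * v| ≤ 3 * (n : ℤ) + ((k : ℤ) + 1) * R' := by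
    rw [abs_le]; constructor <;> linarith
  -- the stride levels versus `mod`
  have hs1 : (shearUnit n h : ℤ) * (((n : ℤ) * ℓ - (shearUnit n h : ℕ) + 1) / (shearUnit n h : ℕ)) ≤ mod := by
    have := Int.ediv_mul_le ((n : ℤ) * ℓ - (shearUnit n h : ℕ) + 1) hU0.ne'
    rw [mul_comm] at this; linarith
  have hs2 : mod - 2 * (shearUnit n h : ℤ) + 2 ≤ (shearUnit n h : ℤ) * (((n : ℤ) * ℓ - (shearUnit n h : ℕ) + 1) / (shearUnit n h : ℕ)) := by
    have := Int.lt_ediv_add_one_mul_self ((n : ℤ) * ℓ - (shearUnit n h : ℕ) + 1) hU0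
    have e : (((n : ℤ) * ℓ - (shearUnit n h : ℕ) + 1) / (shearUnit n h : ℕ) + 1) * (shearUnit n h : ℤ) =
        (shearUnit n h : ℤ) * (((n : ℤ) * ℓ - (shearUnit n h : ℕ) + 1) / (shearUnit n h : ℕ)) + shearUnit n h := by ring
    linarith
  have hs4 : (shearUnit n h : ℤ) * ((n : ℤ) * ℓ / (shearUnit n h : ℕ) + 1) ≤ mod + 2 * (shearUnit n h : ℤ) - 1 := by
    have := Int.ediv_mul_le ((n : ℤ) * ℓ) hU0.ne'
    have e : (shearUnit n h : ℤ) * ((n : ℤ) * ℓ / (shearUnit n h : ℕ) + 1) = (n : ℤ) * ℓ / (shearUnit n h : ℕ) * (shearUnit n h : ℤ) + shearUnit n h := by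
      ring
    linarith
  -- `U·L` about `k·mod`
  unfold yBoxLoS at hL1
  unfold yBoxHiS at hL2
  set U : ℤ := (shearUnit n h : ℤ) with hU
  set sLo : ℤ := ((n : ℤ) * ℓ - (shearUnit n h : ℕ) + 1) / (shearUnit n h : ℕ) with hsLo
  set sHi : ℤ := (n : ℤ) * ℓ / (shearUnit n h : ℕ) + 1 with hsHi
  set La : ℤ := ((3 * (n * ℓ) / shearUnit n h + 1 : ℕ) : ℤ) with hLa
  set K : ℤ := (k : ℤ) with hK
  have hks1 : K * (mod - 2 * U + 2) ≤ K * (U * sLo) := mul_le_mul_of_nonneg_left hs2 hk0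
  have hks2 : K * (U * sHi) ≤ K * (mod + 2 * U - 1) := mul_le_mul_of_nonneg_left hs4 hk0
  have h1 : U * (K * sLo - q - K * R' - R' - La - 1) ≤ U * L := mul_le_mul_of_nonneg_left hL1 hU0.le
  have h2 : U * L ≤ U * (K * sHi + q + K * R' + R' + La + 1) := mul_le_mul_of_nonneg_left hL2 hU0.le
  have e1 : U * (K * sLo - q - K * R' - R' - La - 1) = K * (U * sLo) - U * q - K * (U * R') - U * R' - U * La - U := by ring
  have e2 : U * (K * sHi + q + K * R' + R' + La + 1) = K * (U * sHi) + U * q + K * (U * R') + U * R' + U * La + U := by ring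
  have e3 : K * (mod - 2 * U + 2) = K * mod - 2 * (K * U) + 2 * K := by ring
  have e4 : K * (mod + 2 * U - 1) = K * mod + 2 * (K * U) - K := by ring
  have e5 : U * (2 * K + q + (K + 1) * R' + La + 1) = 2 * (K * U) + U * q + K * (U * R') + U * R' + U * La + U := by ring
  have hUL : |U * L - K * mod| ≤ U * (2 * K + q + (K + 1) * R' + La + 1) := by
    rw [abs_le]; constructor <;> linarith
  -- combine
  have e : mod * m - v * (U * L) = mod * (m - K * v) - v * (U * L - K * mod) := by ring
  rw [e]
  have hA : |mod * (m - K * v)| ≤ mod * (3 * (n : ℤ) + (K + 1) * R') := by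
    rw [abs_mul, abs_of_pos hmod0]; exact mul_le_mul_of_nonneg_left hdm hmod0.le
  have hB : |v * (U * L - K * mod)| ≤ (n : ℤ) * (U * (2 * K + q + (K + 1) * R' + La + 1)) := by
    rw [abs_mul]; exact mul_le_mul hv hUL (abs_nonneg _) hn0.le
  have hC : (n : ℤ) * (U * (2 * K + q + (K + 1) * R' + La + 1)) ≤ (n : ℤ) * U * (2 * K + q + (K + 1) * R' + La + 2) := by
    have e6 : (n : ℤ) * (U * (2 * K + q + (K + 1) * R' + La + 1)) = (n : ℤ) * U * (2 * K + q + (K + 1) * R' + La + 1) := by ring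
    rw [e6]
    exact mul_le_mul_of_nonneg_left (by linarith) (by positivity)
  calc |mod * (m - K * v) - v * (U * L - K * mod)|
      ≤ |mod * (m - K * v)| + |v * (U * L - K * mod)| := abs_sub _ _
    _ ≤ mod * (3 * (n : ℤ) + (K + 1) * R') + (n : ℤ) * U * (2 * K + q + (K + 1) * R' + La + 2) := by linarith
    _ = yBnd n ℓ h mod q R' k := by simp only [yBnd, hU, hLa, hK]

/-- **THE α–β′ CORRELATION ALONG THE y′-RUN, signed form**: for the transverse ends `m ∈ {min, max}(τ·yBoxLoT, τ·yBoxHiT)` of region `k` read with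
sign `τ = ±1` and every level `L ∈ [min(τ·yBoxLoS, τ·yBoxHiS) − 1, max(…) + 1]`, `|mod·m − v·U·L| ≤ Bnd_k`. [cite: MartineauTassion2017, §4.1] -/
theorem yRun_corr {n ℓ : ℕ} (hn : 1 ≤ n) {h v mod : ℤ} (hv : |v| ≤ n) (hmod0 : 0 < mod) (hmodlo : (n : ℤ) * ℓ - (shearUnit n h : ℤ) + 1 ≤ mod)
    (hmodhi : mod ≤ (n : ℤ) * ℓ) {τ : ℤ} (hτ : τ = 1 ∨ τ = -1) (q R' k : ℕ) {m : ℤ}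
    (hm1 : min (τ * yBoxLoT n v R' k) (τ * yBoxHiT n v R' k) ≤ m) (hm2 : m ≤ max (τ * yBoxLoT n v R' k) (τ * yBoxHiT n v R' k)) {L : ℤ}
    (hL1 : min (τ * yBoxLoS n ℓ h q R' k) (τ * yBoxHiS n ℓ h q R' k) - 1 ≤ L) (hL2 : L ≤ max (τ * yBoxLoS n ℓ h q R' k) (τ * yBoxHiS n ℓ h q R' k) + 1) :
    |mod * m - v * ((shearUnit n h : ℤ) * L)| ≤ yBnd n ℓ h mod q R' k := by
  have hvv := abs_le.1 hv
  have hT : yBoxLoT n v R' k ≤ yBoxHiT n v R' k := by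
    unfold yBoxLoT yBoxHiT
    rw [Int.toNat_of_nonneg (by linarith : (0 : ℤ) ≤ (n : ℤ) + v), Int.toNat_of_nonneg (by linarith : (0 : ℤ) ≤ (n : ℤ) - v)]
    nlinarith [show (0:ℤ) ≤ (k : ℤ) * R' from by positivity, show (0 : ℤ) ≤ (R' : ℤ) from by positivity]
  have hS : yBoxLoS n ℓ h q R' k ≤ yBoxHiS n ℓ h q R' k := by
    unfold yBoxLoS yBoxHiS
    have hU0 : 0 < (shearUnit n h : ℤ) := shearUnit_pos hn h
    have : ((n : ℤ) * ℓ - (shearUnit n h : ℕ) + 1) / (shearUnit n h : ℕ) ≤ (n : ℤ) * ℓ / (shearUnit n h : ℕ) := Int.ediv_le_ediv hU0 (by linarith)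
    have hk0 : (0 : ℤ) ≤ k := by positivity
    have := mul_le_mul_of_nonneg_left this hk0
    nlinarith [show (0:ℤ) ≤ (k : ℤ) * R' from by positivity, show (0 : ℤ) ≤ (R' : ℤ) from by positivity, show (0 : ℤ) ≤ (q : ℤ) from by positivity,
      show (0 : ℤ) ≤ ((3 * (n * ℓ) / shearUnit n h + 1 : ℕ) : ℤ) from by positivity]
  rcases hτ with rfl | rfl
  · simp only [one_mul] at hm1 hm2 hL1 hL2
    rw [min_eq_left hT] at hm1; rw [max_eq_right hT] at hm2; rw [min_eq_left hS] at hL1; rw [max_eq_right hS] at hL2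
    exact yRun_corr_aux hn hv hmod0 hmodlo hmodhi q R' k hm1 hm2 hL1 hL2
  · simp only [neg_one_mul] at hm1 hm2 hL1 hL2
    rw [min_eq_right (neg_le_neg hT)] at hm1; rw [max_eq_left (neg_le_neg hT)] at hm2
    rw [min_eq_right (neg_le_neg hS)] at hL1; rw [max_eq_left (neg_le_neg hS)] at hL2
    have key := yRun_corr_aux hn hv hmod0 hmodlo hmodhi q R' k (m := -m) (L := -L) (by linarith) (by linarith) (by linarith) (by linarith)
    have e : mod * m - v * ((shearUnit n h : ℤ) * L) = -(mod * -m - v * ((shearUnit n h : ℤ) * -L)) := by ring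
    rw [e, abs_neg]; exact key

/-- Signed lower level end of region `k`: `min(τ·yBoxLoS, τ·yBoxHiS)`. [folklore] -/
def ySLo (n ℓ : ℕ) (h : ℤ) (q R' : ℕ) (τ : ℤ) (k : ℕ) : ℤ := min (τ * yBoxLoS n ℓ h q R' k) (τ * yBoxHiS n ℓ h q R' k)

/-- Signed upper level end of region `k`: `max(τ·yBoxLoS, τ·yBoxHiS)`. [folklore] -/
def ySHi (n ℓ : ℕ) (h : ℤ) (q R' : ℕ) (τ : ℤ) (k : ℕ) : ℤ := max (τ * yBoxLoS n ℓ h q R' k) (τ * yBoxHiS n ℓ h q R' k)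

/-- **THE y′-RUN'S PER-REGION FOOTPRINT FROM LINEAR FLOORS** (tangential run of an x-face: along cells on axis `0`, levels on axis `1`): for the
y′-run `yRunSched hn hv hlay R′ q N` read in `runY φ cT n h vα τ` with origin cell readings `f₀ = ⌊c₀λ₀(yT)⌋`, `f₁ = ⌊c₁λ₁(yT)⌋`, there are
reading boxes `YLO YHI` satisfying the fields `hregY, hY0–hY3, hYf₁₂₃` of `FaceRunNums3`, provided the six linear floors hold for every
`k ≤ N` (`Bnd_k = yBnd …`, habitat sign `σ = sgOf du`). [cite: KozmaNitzan2024, §4 Lemma 12 (pp. 23–25)] -/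
theorem yRun_footprint_of_floors {A vα vβ c₀ c₁ D κ₀ κ₁ mod : ℤ} {n : ℕ} (hn : 1 ≤ n) {h : ℤ} (hA : 0 < A) (hκ₀ : 0 ≤ κ₀)
    (hc0 : c₀ = A * κ₀) (hc1 : c₁ = A * κ₁) (hmod : modulus n h vα vβ = mod) (hmod0 : 0 < mod) (hD : D = A ^ 2 * mod) (hv : |vα| ≤ n)
    {ℓ : ℕ} (hlay : (n + h.natAbs : ℕ) ≤ (n : ℤ) * ℓ + 1) (hmodlo : (n : ℤ) * ℓ - (shearUnit n h : ℤ) + 1 ≤ mod) (hmodhi : mod ≤ (n : ℤ) * ℓ)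
    (yT : Site 2) {τ : ℤ} (hτ : τ = 1 ∨ τ = -1) (du : MDir) (hdu : du.1 = 0) (R' q N : ℕ) {flo fhi fw : ℤ}
    (FY1 : sgOf du = 1 → ∀ k ≤ N, (n : ℤ) * mod * (flo - coarse c₀ (D / 2) D (lam0 A vα vβ yT)) ≤ -(κ₀ * (yBnd n ℓ h mod q R' k + 2 * n)) - n * mod)
    (FY2 : sgOf du = 1 → ∀ k ≤ N, (n : ℤ) * mod * (coarse c₀ (D / 2) D (lam0 A vα vβ yT) + 1) + κ₀ * (yBnd n ℓ h mod q R' k + n) ≤ n * mod * fhi)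
    (FY3 : sgOf du = -1 → ∀ k ≤ N, (n : ℤ) * mod * (flo + coarse c₀ (D / 2) D (lam0 A vα vβ yT) + 1) ≤ -(κ₀ * (yBnd n ℓ h mod q R' k + n)))
    (FY4 : sgOf du = -1 → ∀ k ≤ N, -((n : ℤ) * mod * coarse c₀ (D / 2) D (lam0 A vα vβ yT)) + κ₀ * (yBnd n ℓ h mod q R' k + 2 * n) + n * mod ≤
      n * mod * fhi)
    (FY5 : ∀ k ≤ N, mod * (-fw - coarse c₁ (D / 2) D (lam1 A n h yT)) ≤ κ₁ * ((shearUnit n h : ℤ) * (ySLo n ℓ h q R' τ k - 1)) - mod + 1)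
    (FY6 : ∀ k ≤ N, mod * (coarse c₁ (D / 2) D (lam1 A n h yT) + 1) + κ₁ * ((shearUnit n h : ℤ) * ySHi n ℓ h q R' τ k + shearUnit n h - 1) ≤ mod * fw) :
    ∃ (YLO YHI : ℕ → Site 2),
      (∀ k ≤ N, (yRunSched hn hv hlay R' q N).region k ⊆
        Finset.Icc (pt (yBoxLoS n ℓ h q R' k) (yBoxLoT n vα R' k)) (pt (yBoxHiS n ℓ h q R' k) (yBoxHiT n vα R' k))) ∧
      (∀ k ≤ N, YLO k 0 ≤ coarse c₀ (D / 2) D (lam0 A vα vβ yT) +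
        (c₀ * (A * (modulus n h vα vβ * (min (τ * yBoxLoT n vα R' k) (τ * yBoxHiT n vα R' k)) -
          max (vα * ((shearUnit n h : ℤ) * (min (τ * yBoxLoS n ℓ h q R' k) (τ * yBoxHiS n ℓ h q R' k) - 1)))
            (vα * ((shearUnit n h : ℤ) * (max (τ * yBoxLoS n ℓ h q R' k) (τ * yBoxHiS n ℓ h q R' k)) + shearUnit n h - 1))) / n)) / D) ∧
      (∀ k ≤ N, coarse c₀ (D / 2) D (lam0 A vα vβ yT) +
        (c₀ * (A * (modulus n h vα vβ * (max (τ * yBoxLoT n vα R' k) (τ * yBoxHiT n vα R' k)) -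
          min (vα * ((shearUnit n h : ℤ) * (min (τ * yBoxLoS n ℓ h q R' k) (τ * yBoxHiS n ℓ h q R' k) - 1)))
            (vα * ((shearUnit n h : ℤ) * (max (τ * yBoxLoS n ℓ h q R' k) (τ * yBoxHiS n ℓ h q R' k)) + shearUnit n h - 1))) / n)) / D + 1 ≤ YHI k 0) ∧
      (∀ k ≤ N, YLO k 1 ≤ coarse c₁ (D / 2) D (lam1 A n h yT) +
        (c₁ * (A * ((shearUnit n h : ℤ) * (min (τ * yBoxLoS n ℓ h q R' k) (τ * yBoxHiS n ℓ h q R' k) - 1)))) / D) ∧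
      (∀ k ≤ N, coarse c₁ (D / 2) D (lam1 A n h yT) +
        (c₁ * (A * ((shearUnit n h : ℤ) * (max (τ * yBoxLoS n ℓ h q R' k) (τ * yBoxHiS n ℓ h q R' k)) + shearUnit n h - 1))) / D + 1 ≤ YHI k 1) ∧
      (∀ k ≤ N, sgOf du = 1 → flo ≤ YLO k du.1 ∧ YHI k du.1 ≤ fhi) ∧
      (∀ k ≤ N, sgOf du = -1 → flo ≤ -YHI k du.1 ∧ -YLO k du.1 ≤ fhi) ∧
      (∀ k ≤ N, -fw ≤ YLO k (oth du.1) ∧ YHI k (oth du.1) ≤ fw) := by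
  set f₀ := coarse c₀ (D / 2) D (lam0 A vα vβ yT) with hf₀
  set f₁ := coarse c₁ (D / 2) D (lam1 A n h yT) with hf₁
  set U : ℤ := (shearUnit n h : ℤ) with hU
  have hn0 : (0 : ℤ) < n := by exact_mod_cast hn
  have hnm : 0 < (n : ℤ) * mod := mul_pos hn0 hmod0
  set sL := yBoxLoS n ℓ h q R' with hsL
  set sH := yBoxHiS n ℓ h q R' with hsH
  set tL := yBoxLoT n vα R' with htL
  set tH := yBoxHiT n vα R' with htH
  -- the level range of region k (signed): `[ms − 1, Ms]`
  have hmsMs : ∀ k, min (τ * sL k) (τ * sH k) ≤ max (τ * sL k) (τ * sH k) + 1 := fun k => by linarith [min_le_max (a := τ * sL k) (b := τ * sH k)]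
  -- the correlation bounds of the two transverse ends
  have hcorr : ∀ k (m : ℤ), (m = min (τ * tL k) (τ * tH k) ∨ m = max (τ * tL k) (τ * tH k)) →
      ∀ L : ℤ, min (τ * sL k) (τ * sH k) - 1 ≤ L → L ≤ max (τ * sL k) (τ * sH k) + 1 → |mod * m - vα * (U * L)| ≤ yBnd n ℓ h mod q R' k := by
    intro k m hm L hL1 hL2
    refine yRun_corr hn hv hmod0 hmodlo hmodhi hτ q R' k ?_ ?_ hL1 hL2
    · rcases hm with rfl | rfl
      · exact le_rfl
      · exact min_le_max
    · rcases hm with rfl | rfl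
      · exact min_le_max
      · exact le_rfl
  let X0lo : ℕ → ℤ := fun k => (c₀ * (A * (modulus n h vα vβ * (min (τ * tL k) (τ * tH k)) -
      max (vα * (U * (min (τ * sL k) (τ * sH k) - 1))) (vα * (U * (max (τ * sL k) (τ * sH k)) + U - 1))) / n)) / D
  let X0hi : ℕ → ℤ := fun k => (c₀ * (A * (modulus n h vα vβ * (max (τ * tL k) (τ * tH k)) -
      min (vα * (U * (min (τ * sL k) (τ * sH k) - 1))) (vα * (U * (max (τ * sL k) (τ * sH k)) + U - 1))) / n)) / D
  let X1lo : ℕ → ℤ := fun k => (c₁ * (A * (U * (min (τ * sL k) (τ * sH k) - 1)))) / D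
  let X1hi : ℕ → ℤ := fun k => (c₁ * (A * (U * (max (τ * sL k) (τ * sH k)) + U - 1))) / D
  refine ⟨fun k => pt (f₀ + X0lo k) (f₁ + X1lo k), fun k => pt (f₀ + X0hi k + 1) (f₁ + X1hi k + 1),
    fun k _ => yRunSched_region_subset_yBox hn hv hlay R' q N k, fun k _ => le_of_eq (pt_zero _ _), fun k _ => le_of_eq (pt_zero _ _).symm,
    fun k _ => le_of_eq (pt_one _ _), fun k _ => le_of_eq (pt_one _ _).symm, ?_, ?_, ?_⟩
  · intro k hk h1
    rw [hdu]; simp only [pt_zero]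
    have hlo := (read0_corr_lo_bounds (U := U) hA hκ₀ hmod0 hn0 hc0 hD hv (hmsMs k) (hcorr k _ (Or.inl rfl))).1
    have hhi := (read0_corr_hi_bounds (U := U) hA hκ₀ hmod0 hn0 hc0 hD hv (hmsMs k) (hcorr k _ (Or.inr rfl))).2
    have f1 := FY1 h1 k hk
    have f2 := FY2 h1 k hk
    constructor
    · show flo ≤ f₀ + X0lo k
      have e : X0lo k = (c₀ * (A * (mod * (min (τ * tL k) (τ * tH k)) -
          max (vα * (U * (min (τ * sL k) (τ * sH k) - 1))) (vα * (U * (max (τ * sL k) (τ * sH k)) + U - 1))) / n)) / D := by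
        simp only [X0lo, hmod]
      rw [e]
      exact le_of_mul_le_mul_left (by linarith) hnm
    · show f₀ + X0hi k + 1 ≤ fhi
      have e : X0hi k = (c₀ * (A * (mod * (max (τ * tL k) (τ * tH k)) -
          min (vα * (U * (min (τ * sL k) (τ * sH k) - 1))) (vα * (U * (max (τ * sL k) (τ * sH k)) + U - 1))) / n)) / D := by
        simp only [X0hi, hmod]
      rw [e]
      exact le_of_mul_le_mul_left (by linarith) hnm
  · intro k hk h1
    rw [hdu]; simp only [pt_zero]
    have hlo := (read0_corr_lo_bounds (U := U) hA hκ₀ hmod0 hn0 hc0 hD hv (hmsMs k) (hcorr k _ (Or.inl rfl))).1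
    have hhi := (read0_corr_hi_bounds (U := U) hA hκ₀ hmod0 hn0 hc0 hD hv (hmsMs k) (hcorr k _ (Or.inr rfl))).2
    have f3 := FY3 h1 k hk
    have f4 := FY4 h1 k hk
    constructor
    · show flo ≤ -(f₀ + X0hi k + 1)
      have e : X0hi k = (c₀ * (A * (mod * (max (τ * tL k) (τ * tH k)) -
          min (vα * (U * (min (τ * sL k) (τ * sH k) - 1))) (vα * (U * (max (τ * sL k) (τ * sH k)) + U - 1))) / n)) / D := by
        simp only [X0hi, hmod]
      rw [e]
      exact le_of_mul_le_mul_left (by linarith) hnm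
    · show -(f₀ + X0lo k) ≤ fhi
      have e : X0lo k = (c₀ * (A * (mod * (min (τ * tL k) (τ * tH k)) -
          max (vα * (U * (min (τ * sL k) (τ * sH k) - 1))) (vα * (U * (max (τ * sL k) (τ * sH k)) + U - 1))) / n)) / D := by
        simp only [X0lo, hmod]
      rw [e]
      exact le_of_mul_le_mul_left (by linarith) hnm
  · intro k hk
    rw [hdu, show oth (0 : Fin 2) = 1 from rfl]; simp only [pt_one]
    obtain ⟨⟨hlo, -⟩, -, hhi⟩ := read1_gen_bounds (U := U) (κ₁ := κ₁) hA hmod0 hc1 hD (min (τ * sL k) (τ * sH k)) (max (τ * sL k) (τ * sH k))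
    have f5 := FY5 k hk
    have f6 := FY6 k hk
    simp only [ySLo, ySHi, ← hsL, ← hsH] at f5 f6
    constructor
    · show -fw ≤ f₁ + X1lo k
      exact le_of_mul_le_mul_left (by simp only [X1lo]; linarith) hmod0
    · show f₁ + X1hi k + 1 ≤ fw
      exact le_of_mul_le_mul_left (by simp only [X1hi]; linarith) hmod0

end Skelφ

end Summit.CriticalPhenomena.PercolationContinuityZ3.Theorems.Transplant
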